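import Summits.Ventures.HSemireg.WedgeHankelRecurrenceGaussSumRuleBounds

/-!
# Venture HSemireg — **THE JACOBI RECURRENCE IN KARLIN–McGREGOR ∕ WALL–WETZEL COORDINATES: ALL ZEROS OF `P^{(α,β)}_{t+1}` LIE IN `(−1, 1)`** (`α, β > −1`). For the monic Jacobi recurrence
# `a_0 = (β−α)∕(σ+2)`, `a_n = (β²−α²)∕((2n+σ)(2n+σ+2))`, `b_1 = 4(1+α)(1+β)∕((σ+2)²(σ+3))`, `b_n = 4n(n+α)(n+β)(n+σ)∕((2n+σ−1)(2n+σ)²(2n+σ+1))` (`σ = α + β`) one has the EXPLICIT rates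
# `λ_0 = (α+1)∕(σ+2)`, `λ_n = (n+α+1)(n+σ+1)∕((2n+σ+1)(2n+σ+2))`, `μ_0 = 0`, `μ_n = n(n+β)∕((2n+σ)(2n+σ+1))` with **`1 − a_n = 2(λ_n + μ_n)`, `b_{n+1} = 4 λ_n μ_{n+1}`**; hence `b_{n+1} = (1 − g_n) g_{n+1}
# (1 − a_n)(1 − a_{n+1})` with `g_n = μ_n∕(λ_n + μ_n)` and N372 puts every zero below `1`; the `α ↔ β` reflection puts every zero above `−1`

HONEST FRAMING. Part of the Lean index of the computation cell `pub-hsemireg` (seat p10 gen 46, Sunday typer «UNIFORM-IN-n»).  Rational identities and finite products only; no variety, no cohomology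
theory, no sheaf, no Ext group and no semiregularity map is constructed here; nothing here says that HC / HC_CM / HC_AV holds; no Literature fact (unproved `Prop`) is declared or used.  Custodian
versions as in `WedgeHankelSiegelIdeal` (1/3).
SOURCES (cited).  G. Szegő, *Orthogonal Polynomials*, (4.5.1) (the Jacobi recurrence), Thm 3.3.1 ∕ §6.21 (zeros in `(−1,1)`); S. Karlin, J. McGregor, *The differential equations of birth-and-death
processes*, Trans. Amer. Math. Soc. 85 (1957) 489–546 (the Jacobi rates); T. S. Chihara, *An Introduction to Orthogonal Polynomials* (1978), Ch. IV §2, Ch. V §2 (A); M. E. H. Ismail, *Classical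
and Quantum Orthogonal Polynomials* (2005), §4.1–4.2, Thm 7.2.1; W. Gautschi, *Orthogonal Polynomials* (2004), Table 1.1.
PROOF TYPED HERE.  The two rational identities per index (`n = 0` with the cancelled forms, `n ≥ 1` generic) by `field_simp; ring`; positivity of the rates for `α, β > −1`; N372 `zeros_lt_of_chain`
with `B = 1`, equality in the comparison; the lower end point from the reflected recurrence `(−a, b)` (N325 `recurrence_reflect_spec`), which is the Jacobi recurrence with `α`, `β` exchanged.
DEDUP DISCLOSURE (`rg -n -i 'jacobi_zeros|jacobi_birth|jacobi recurrence' Summits/Ventures/HSemireg/WedgeHankelRecurrenceGauss*`, 2026-09-03): N390 (`α = β`, Gegenbauer), N352 (discrete Jacobi-type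
weights, Markov); the general `(α, β)` recurrence is new.  The 4 names below: 0 hits tree-wide.

WHAT IS IN THE TREE.  N372 `zeros_lt_of_chain`; N325 `recurrence_reflect_spec`.
THIS FILE (namespace `Summit.Ventures.HSemireg.Wedge.HankelOuter` continued; CHAINED on N401 (import only); 0 definitions):
* §1167 `jacobi_rates_identities` (`1 − a_n = 2(λ_n + μ_n)`, `b_{n+1} = 4λ_n μ_{n+1}`, `λ_n > 0`, `μ_{n+1} > 0`), **`jacobi_zeros_lt_one`**, **`jacobi_zeros_gt_neg_one`**, **`jacobi_zeros_mem`**.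
CAVEATS.  `α, β > −1`; the coefficients `a_0`, `b_1` are given in their cancelled forms (the generic formulas are `0∕0` at `α + β ∈ {0, −1}`).  Nothing Ext-side.  New names only.
-/

open Module Polynomial
open scoped Matrix Polynomial

namespace Summit.Ventures.HSemireg.Wedge.HankelOuter

/-! ## §1167. Jacobi zeros via the Karlin–McGregor rates -/

/-- **THE JACOBI RATES: `1 − a_n = 2(λ_n + μ_n)`, `b_{n+1} = 4 λ_n μ_{n+1}`, `λ_n > 0`, `μ_{n+1} > 0`** (`α, β > −1`). [Karlin–McGregor 1957; Ismail §4.2; this file, §1167] -/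
theorem jacobi_rates_identities {a b : ℕ → ℝ} {α β : ℝ} (hα : -1 < α) (hβ : -1 < β) (ha0 : a 0 = (β - α) / (α + β + 2))
    (ha : ∀ n : ℕ, a (n + 1) = (β ^ 2 - α ^ 2) / ((2 * n + 2 + (α + β)) * (2 * n + 4 + (α + β))))
    (hb1 : b 1 = 4 * (1 + α) * (1 + β) / ((α + β + 2) ^ 2 * (α + β + 3)))
    (hb : ∀ n : ℕ, b (n + 2) = 4 * ((n : ℝ) + 2) * ((n : ℝ) + 2 + α) * ((n : ℝ) + 2 + β) * ((n : ℝ) + 2 + (α + β)) /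
      ((2 * n + 3 + (α + β)) * (2 * n + 4 + (α + β)) ^ 2 * (2 * n + 5 + (α + β)))) :
    ∃ l m : ℕ → ℝ, m 0 = 0 ∧ (∀ n, 0 < l n) ∧ (∀ n, 0 < m (n + 1)) ∧ (∀ n, 1 - a n = 2 * (l n + m n)) ∧ ∀ n, b (n + 1) = 4 * l n * m (n + 1) := by
  refine ⟨fun n => if n = 0 then (α + 1) / (α + β + 2) else ((n : ℝ) + 1 + α) * ((n : ℝ) + 1 + (α + β)) / ((2 * n + 1 + (α + β)) * (2 * n + 2 + (α + β))),
    fun n => if n = 0 then 0 else (n : ℝ) * ((n : ℝ) + β) / ((2 * n + (α + β)) * (2 * n + 1 + (α + β))), if_pos rfl, fun n => ?_, fun n => ?_, fun n => ?_, fun n => ?_⟩ <;>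
    dsimp only
  · rcases n with _ | k
    · rw [if_pos rfl]; exact div_pos (by linarith) (by linarith)
    · rw [if_neg (Nat.succ_ne_zero k)]
      have h0 : (0 : ℝ) ≤ k := Nat.cast_nonneg k
      push_cast
      exact div_pos (mul_pos (by linarith) (by linarith)) (mul_pos (by linarith) (by linarith))
  · rw [if_neg (Nat.succ_ne_zero n)]
    have h0 : (0 : ℝ) ≤ n := Nat.cast_nonneg n
    push_cast
    exact div_pos (mul_pos (by linarith) (by linarith)) (mul_pos (by linarith) (by linarith))
  · rcases n with _ | k
    · rw [if_pos rfl, if_pos rfl, ha0]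
      have h2 : α + β + 2 ≠ 0 := by linarith
      field_simp; ring
    · rw [if_neg (Nat.succ_ne_zero k), if_neg (Nat.succ_ne_zero k), ha k]
      have h0 : (0 : ℝ) ≤ k := Nat.cast_nonneg k
      push_cast
      have h1 : (2 * (k : ℝ) + 2 + (α + β)) ≠ 0 := by linarith
      have h2 : (2 * (k : ℝ) + 4 + (α + β)) ≠ 0 := by linarith
      have h3 : (2 * ((k : ℝ) + 1) + 1 + (α + β)) ≠ 0 := by linarith
      have h4 : (2 * ((k : ℝ) + 1) + 2 + (α + β)) ≠ 0 := by linarith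
      have h5 : (2 * ((k : ℝ) + 1) + (α + β)) ≠ 0 := by linarith
      rw [div_add_div _ _ (mul_ne_zero h3 h4) (mul_ne_zero h5 h3), eq_comm, ← sub_eq_zero, one_sub_div (mul_ne_zero h1 h2), mul_div_assoc',
        div_sub_div _ _ (mul_ne_zero (mul_ne_zero h3 h4) (mul_ne_zero h5 h3)) (mul_ne_zero h1 h2), div_eq_zero_iff]
      left
      ring
  · rcases n with _ | k
    · rw [if_pos rfl, if_neg (by norm_num : (0 : ℕ) + 1 ≠ 0), hb1]
      have h2 : α + β + 2 ≠ 0 := by linarith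
      have h3 : α + β + 3 ≠ 0 := by linarith
      have h4 : (2 * ((0 + 1 : ℕ) : ℝ) + (α + β)) ≠ 0 := by push_cast; linarith
      have h5 : (2 * ((0 + 1 : ℕ) : ℝ) + 1 + (α + β)) ≠ 0 := by push_cast; linarith
      have e : ∀ A B D E : ℝ, 4 * (A / B) * (D / E) = 4 * A * D / (B * E) := fun A B D E => by ring
      rw [e]
      refine (div_eq_div_iff (mul_ne_zero (pow_ne_zero 2 h2) h3) (mul_ne_zero h2 (mul_ne_zero h4 h5))).2 ?_
      push_cast
      ring
    · rw [if_neg (Nat.succ_ne_zero k), if_neg (Nat.succ_ne_zero (k + 1)), show k + 1 + 1 = k + 2 from rfl, hb k]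
      have h0 : (0 : ℝ) ≤ k := Nat.cast_nonneg k
      push_cast
      have h1 : (2 * ((k : ℝ) + 1) + 1 + (α + β)) ≠ 0 := by linarith
      have h2 : (2 * ((k : ℝ) + 1) + 2 + (α + β)) ≠ 0 := by linarith
      have h3 : (2 * ((k : ℝ) + 2) + (α + β)) ≠ 0 := by linarith
      have h4 : (2 * ((k : ℝ) + 2) + 1 + (α + β)) ≠ 0 := by linarith
      have h5 : (2 * (k : ℝ) + 3 + (α + β)) ≠ 0 := by linarith
      have h6 : (2 * (k : ℝ) + 4 + (α + β)) ≠ 0 := by linarith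
      have h7 : (2 * (k : ℝ) + 5 + (α + β)) ≠ 0 := by linarith
      have e : ∀ A B D E : ℝ, 4 * (A / B) * (D / E) = 4 * A * D / (B * E) := fun A B D E => by ring
      rw [e, div_eq_div_iff (mul_ne_zero (mul_ne_zero h5 (pow_ne_zero 2 h6)) h7) (mul_ne_zero (mul_ne_zero h1 h2) (mul_ne_zero h3 h4))]
      ring

/-- **JACOBI: every zero of `P^{(α,β)}_{t+1}` is `< 1`** (`α, β > −1`; Wall–Wetzel at `B = 1` with the Karlin–McGregor parameters, equality in the comparison). [Szegő §6.21; Chihara IV §2; this file,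
§1167] -/
theorem jacobi_zeros_lt_one {q : ℕ → ℝ[X]} {a b : ℕ → ℝ} {α β : ℝ} (hq0 : q 0 = 1) (hq1 : q 1 = Polynomial.X - C (a 0))
    (hrec : ∀ n, q (n + 2) = (Polynomial.X - C (a (n + 1))) * q (n + 1) - C (b (n + 1)) * q n) (hα : -1 < α) (hβ : -1 < β) (ha0 : a 0 = (β - α) / (α + β + 2))
    (ha : ∀ n : ℕ, a (n + 1) = (β ^ 2 - α ^ 2) / ((2 * n + 2 + (α + β)) * (2 * n + 4 + (α + β))))
    (hb1 : b 1 = 4 * (1 + α) * (1 + β) / ((α + β + 2) ^ 2 * (α + β + 3)))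
    (hb : ∀ n : ℕ, b (n + 2) = 4 * ((n : ℝ) + 2) * ((n : ℝ) + 2 + α) * ((n : ℝ) + 2 + β) * ((n : ℝ) + 2 + (α + β)) /
      ((2 * n + 3 + (α + β)) * (2 * n + 4 + (α + β)) ^ 2 * (2 * n + 5 + (α + β)))) (hb0 : 0 < b 0) (t : ℕ) :
    ∀ s, (q (t + 1)).eval s = 0 → s < 1 := by
  obtain ⟨l, m, hm0, hl, hm, hA, hB⟩ := jacobi_rates_identities hα hβ ha0 ha hb1 hb
  have hmnn : ∀ n, 0 ≤ m n := fun n => by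
    rcases n with _ | k
    · rw [hm0]
    · exact (hm k).le
  have hbpos : ∀ j, 0 < b j := fun j => by
    rcases j with _ | k
    · exact hb0
    · rw [hB]; exact mul_pos (mul_pos (by norm_num) (hl k)) (hm k)
  have h1a : ∀ n, 0 < 1 - a n := fun n => by rw [hA]; linarith [hl n, hmnn n]
  refine zeros_lt_of_chain hq0 hq1 hrec hbpos (B := 1) (g := fun n => m n / (l n + m n)) (fun n _ => by linarith [h1a n])
    (fun n _ => ⟨div_nonneg (hmnn n) (by linarith [hl n, hmnn n]), (div_lt_one (by linarith [hl n, hmnn n])).2 (by linarith [hl n])⟩) fun n _ => le_of_eq ?_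
  have h0 : l n + m n ≠ 0 := by linarith [hl n, hmnn n]
  have h1 : l (n + 1) + m (n + 1) ≠ 0 := by linarith [hl (n + 1), hmnn (n + 1)]
  rw [hB, hA, hA]
  field_simp
  ring

/-- **JACOBI: every zero of `P^{(α,β)}_{t+1}` is `> −1`** — the reflected recurrence `(−a, b)` is the Jacobi recurrence with `α` and `β` exchanged. [Szegő §6.21; this file, §1167] -/
theorem jacobi_zeros_gt_neg_one {q : ℕ → ℝ[X]} {a b : ℕ → ℝ} {α β : ℝ} (hq0 : q 0 = 1) (hq1 : q 1 = Polynomial.X - C (a 0))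
    (hrec : ∀ n, q (n + 2) = (Polynomial.X - C (a (n + 1))) * q (n + 1) - C (b (n + 1)) * q n) (hα : -1 < α) (hβ : -1 < β) (ha0 : a 0 = (β - α) / (α + β + 2))
    (ha : ∀ n : ℕ, a (n + 1) = (β ^ 2 - α ^ 2) / ((2 * n + 2 + (α + β)) * (2 * n + 4 + (α + β))))
    (hb1 : b 1 = 4 * (1 + α) * (1 + β) / ((α + β + 2) ^ 2 * (α + β + 3)))
    (hb : ∀ n : ℕ, b (n + 2) = 4 * ((n : ℝ) + 2) * ((n : ℝ) + 2 + α) * ((n : ℝ) + 2 + β) * ((n : ℝ) + 2 + (α + β)) /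
      ((2 * n + 3 + (α + β)) * (2 * n + 4 + (α + β)) ^ 2 * (2 * n + 5 + (α + β)))) (hb0 : 0 < b 0) (t : ℕ) :
    ∀ s, (q (t + 1)).eval s = 0 → -1 < s := by
  obtain ⟨h0', h1', hrec', -⟩ := recurrence_reflect_spec hq0 hq1 hrec
  -- the reflected data are the `(β, α)` Jacobi data
  have key := jacobi_zeros_lt_one (q := fun n => C ((-1 : ℝ) ^ n) * (q n).comp (C (-1 : ℝ)⁻¹ * Polynomial.X)) (a := fun n => -a n) (b := b) (α := β) (β := α) h0' h1' hrec' hβ hα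
    (by rw [ha0]; have : α + β + 2 ≠ 0 := by linarith
        rw [show β + α + 2 = α + β + 2 by ring]; field_simp; ring)
    (fun n => by
      rw [ha n, show β + α = α + β by ring]
      have h0 : (0 : ℝ) ≤ n := Nat.cast_nonneg n
      have h1 : (2 * (n : ℝ) + 2 + (α + β)) * (2 * n + 4 + (α + β)) ≠ 0 := mul_ne_zero (by linarith) (by linarith)
      field_simp; ring)
    (by rw [hb1, show β + α = α + β by ring]; ring) (fun n => by rw [hb n, show β + α = α + β by ring]; ring) hb0 t
  intro s hs
  have hs' : (C ((-1 : ℝ) ^ (t + 1)) * (q (t + 1)).comp (C (-1 : ℝ)⁻¹ * Polynomial.X)).eval (-s) = 0 := by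
    rw [eval_mul, eval_C, eval_comp, eval_mul, eval_C, eval_X, show (-1 : ℝ)⁻¹ * -s = s by norm_num, hs, mul_zero]
  have := key (-s) hs'
  linarith

/-- **JACOBI: all zeros of `P^{(α,β)}_{t+1}` lie in `(−1, 1)`** (`α, β > −1`). [Szegő Thm 3.3.1, §6.21; this file, §1167] -/
theorem jacobi_zeros_mem {q : ℕ → ℝ[X]} {a b : ℕ → ℝ} {α β : ℝ} (hq0 : q 0 = 1) (hq1 : q 1 = Polynomial.X - C (a 0))
    (hrec : ∀ n, q (n + 2) = (Polynomial.X - C (a (n + 1))) * q (n + 1) - C (b (n + 1)) * q n) (hα : -1 < α) (hβ : -1 < β) (ha0 : a 0 = (β - α) / (α + β + 2))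
    (ha : ∀ n : ℕ, a (n + 1) = (β ^ 2 - α ^ 2) / ((2 * n + 2 + (α + β)) * (2 * n + 4 + (α + β))))
    (hb1 : b 1 = 4 * (1 + α) * (1 + β) / ((α + β + 2) ^ 2 * (α + β + 3)))
    (hb : ∀ n : ℕ, b (n + 2) = 4 * ((n : ℝ) + 2) * ((n : ℝ) + 2 + α) * ((n : ℝ) + 2 + β) * ((n : ℝ) + 2 + (α + β)) /
      ((2 * n + 3 + (α + β)) * (2 * n + 4 + (α + β)) ^ 2 * (2 * n + 5 + (α + β)))) (hb0 : 0 < b 0) (t : ℕ) :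
    ∀ s, (q (t + 1)).eval s = 0 → -1 < s ∧ s < 1 := fun s hs =>
  ⟨jacobi_zeros_gt_neg_one hq0 hq1 hrec hα hβ ha0 ha hb1 hb hb0 t s hs, jacobi_zeros_lt_one hq0 hq1 hrec hα hβ ha0 ha hb1 hb hb0 t s hs⟩

end Summit.Ventures.HSemireg.Wedge.HankelOuter
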